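import Summits.QuantumFields.YangMills.Theorems.SwapVirialDeficitSectorLaplacePlaneParts
import Summits.QuantumFields.YangMills.Theorems.SwapVirialDeficitBlowUpVirialRing
import HarnessLib

/-!
# (S)-road ➎ «localize the two-sided law»: THE SECTOR STIFFNESS `(TS)_000` AS A SUM OVER HUB REGIONS (tip ∕ bulk ∕ end × fibre; bad signs pointwise)
# (free-hands support of ⟨stmt-QuantumFields-24197⟩ `SwapVirialDeficit.SwapGluedStiffness`; cell ym-idea-1, LEAD g98 ruling 2026-08-31 18:47Z ∕ memo5, assembler fcl-p3 g47)

The socket of record for ⟨24197⟩ is ✓`SwapRing.swapGluedStiffness_of_twoSectorStiffness` (w2 g57): per even sector `z ∈ {000, 001}` and on a window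
`(TS)_z : κ·∫e^{−βF_z}dμ_L ≤ β·∫F_z e^{−βF_z}dμ_L`, `κ = 9L⁴ − 3∕2 + c`.  `(TS)_z` is ADDITIVE IN THE MEASURE (LEAD g98 memo5), so it is the SUM of per-REGION stiffness
inequalities.  In the joint gnomonic chart of sector 000 (✓`integral_exp_swapDeficit_eq_gnomonic`, ✓`integral_swapDeficit_exp_eq_gnomonic`) the regions are, for the
GOOD sign patterns, the hub partition `ℍ = TipHub τ ⊔ EndHub τ ⊔ HubBulk τ` (✓`integral_eq_parts`) × the whole fibre `GnoCoord L`; the BAD sign patterns are a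
remainder on which `κ ≤ bF̂` pointwise (w3 g66 ✓`badSign_floor`).  Letters: ✓`SectorLaplaceDefs` §4 (`hubIntegral`, `TipHub`, `EndHub`) and §5 (`hubActionIntegral`,
`stiffKappa`).

* §1 the hub action integral `E(a,ε;b) = ∫F̂e^{−bF̂}ρ`: bounded action integrand, ★ `stronglyMeasurable_hubActionIntegral`, `integrable_hubActionIntegral`,
  `kappa_hubIntegral_le` (a pointwise floor `κ ≤ bF̂` gives `κ·I ≤ b·E` at the hub);
* §2 ★★ `sectorStiffness_of_regions` — fixed `L`, `b > 0`, cut `τ > 0`, any `κ`: the three REGION stiffness inequalities (tip, bulk, end; chart side, summed over good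
  signs) + the bad-sign pointwise floor ⟹ `κ·∫e^{−bF₀}dμ_L ≤ b·∫F₀e^{−bF₀}dμ_L` on the ring;
* §3 ★★ `h000_of_region_stubs` — the region STUBS of skeleton ➎ (each: `∃ K k τ₀, ∀ L, ∀ τ ≤ τ₀∕L^k, ∀ b ≥ K L^k τ^{−k}`, stiffness with `κ = stiffKappa L (1∕8)`)
  ⟹ the polynomial-window form `∃ K q, ∀ L b, K L^q ≤ b → (TS)_000(b)` (one common cut `τ(L) = τ₀∕L^k`; bad signs above `b ≥ 8100L¹⁰`) = the `h0` input of
  ✓`twoSectorStiffness_of_windows` ∕ ✓`swapGluedStiffness_of_windows` (✓`SectorStiffnessWindows`).  LEAD g98 19:07Z: «the hub-partition design (BULK∕TIP∕END × Gno at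
  one τ(L), remainder = bad signs) is exactly right; END's owner may sub-partition EndHub τ × Gno by (x₀,y₀)»; one-sided (lower) stiffness suffices.

HONEST LABEL: measure-theoretic ∕ arithmetic glue; the region inequalities (tip: w3 g66 + w2 g59 (Rb)(Rc); bulk: fcl-p3 g47 from w2's `bulk_fibred_plane` + S3-on-bulk (Ra);
end: w3 + w2 (Rd); sector 001: w3's charts) are HYPOTHESES here and OPEN; ⟨24197⟩ ∕ ⟨24194⟩ OPEN; ⟨24196⟩ proved elsewhere; item of record ⟨24085⟩ SubOctaveBounded
aside ∕ untouched; the Yang–Mills mass gap is NOT proved; no summit is proved by a line.  THEOREMS ONLY (0 `def`, 0 `sorry`), standard axioms; the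
`attribute [local instance]` block is the chart's measurable structure on `ℍ` (as in ✓`SectorLaplaceDefs`; nothing overridden).  Seat ym-line-fcl-p3 g47 (cell ym-idea-1,
free hands), `--supports stmt-QuantumFields-24197`.  References: [cite: Luscher1983, §2]; [cite: Griffiths1964]; [folklore].
-/

set_option autoImplicit false
set_option synthInstance.maxSize 1024

noncomputable section

open MeasureTheory Quaternion Set
open scoped Quaternion BigOperators ENNReal
open Literature.MathematicalPhysics.QuantumLattice
open Literature.MathematicalPhysics.QuantumFieldTheory hiding SU2
open Summit.QuantumFields.YangMills.Theorems.SwapTwistDeficit.ToronLog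

attribute [local instance] Literature.Analysis.FluidPDE.Tao2016.quatMeasurableSpace
  Literature.Analysis.FluidPDE.Tao2016.quatBorelSpace
  Literature.MathematicalPhysics.QuantumLattice.secondCountableTopology_su2

namespace Summit.QuantumFields.YangMills.Theorems.SwapVirialDeficit.SectorLaplace

open Summit.QuantumFields.YangMills.Theorems.FemtoTransferGap
open Summit.QuantumFields.YangMills.Theorems.FemtoTransferGap.TT
open Summit.QuantumFields.YangMills.Theorems.VirialFluxGap.RingDeficit
open Summit.QuantumFields.YangMills.Theorems.SwapVirialDeficit.SwapRing
open Summit.QuantumFields.YangMills.Theorems.SwapVirialDeficit.BlowUpRing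

variable {L : ℕ} [NeZero L]

/-! ## §1 The hub action integral -/

/-- The chart deficit is bounded: `|F̂_{a,ε}(η)| ≤ B(L)` (it IS the ring deficit read in the chart; ✓`exists_abs_swapRingDeficit_le`). [folklore] -/
theorem exists_abs_gnoDeficit_le : ∃ B : ℝ, 0 ≤ B ∧ ∀ (a : ℍ) (ε : GnoSign L) (η : GnoCoord L), |gnoDeficit z₀ (fun _ => 1) a ε η| ≤ B := by
  obtain ⟨B, hB⟩ := exists_abs_swapRingDeficit_le (L := L) z₀
  refine ⟨B, ?_, fun a ε η => hB _⟩
  obtain ⟨a⟩ : Nonempty ℍ := ⟨0⟩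
  exact (abs_nonneg _).trans (hB (fixHistory (ringConfig (fun _ => 1) (blowUpPoint 1 (gnomonicPoint a
    (((true, true), (true, fun _ => true)) : GnoSign L) (0 : GnoCoord L))))))

/-- The action integrand `F̂·e^{−bF̂}·ρ` is non-negative. [folklore] -/
theorem actionIntegrand_nonneg (b : ℝ) (a : ℍ) (ε : GnoSign L) (η : GnoCoord L) :
    0 ≤ gnoDeficit z₀ (fun _ => 1) a ε η * Real.exp (-(b * gnoDeficit z₀ (fun _ => 1) a ε η)) * gnoDensity η :=
  mul_nonneg (mul_nonneg (gnoDeficit_nonneg _ _ _ _ _) (Real.exp_pos _).le) (gnoDensity_pos η).le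

/-- The action integrand is integrable on the fibre (`b ≥ 0`; bounded by `B·ρ`). [folklore] -/
theorem integrable_actionIntegrand {b : ℝ} (hb : 0 ≤ b) (a : ℍ) (ε : GnoSign L) :
    Integrable fun η : GnoCoord L => gnoDeficit z₀ (fun _ => 1) a ε η * Real.exp (-(b * gnoDeficit z₀ (fun _ => 1) a ε η)) * gnoDensity η := by
  obtain ⟨B, hB0, hB⟩ := exists_abs_gnoDeficit_le (L := L)
  refine ((integrable_gnoDensity (L := L)).const_mul B).mono'
    (((measurable_gnoDeficit z₀ _ a ε).mul ((measurable_gnoDeficit z₀ _ a ε).const_mul b).neg.exp).mul measurable_gnoDensity).aestronglyMeasurable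
    (Filter.Eventually.of_forall fun η => ?_)
  rw [Real.norm_eq_abs, abs_of_nonneg (actionIntegrand_nonneg b a ε η)]
  have h1 : Real.exp (-(b * gnoDeficit z₀ (fun _ => 1) a ε η)) ≤ 1 :=
    Real.exp_le_one_iff.2 (by have := gnoDeficit_nonneg z₀ (fun _ => (1 : SU2)) a ε η; nlinarith)
  have h2 : gnoDeficit z₀ (fun _ => 1) a ε η ≤ B := (le_abs_self _).trans (hB a ε η)
  calc gnoDeficit z₀ (fun _ => 1) a ε η * Real.exp (-(b * gnoDeficit z₀ (fun _ => 1) a ε η)) * gnoDensity η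
      ≤ B * 1 * gnoDensity η := by
        refine mul_le_mul_of_nonneg_right ?_ (gnoDensity_pos η).le
        exact mul_le_mul h2 h1 (Real.exp_pos _).le hB0
    _ = B * gnoDensity η := by ring

/-- `0 ≤ hubActionIntegral`. [folklore] -/
theorem hubActionIntegral_nonneg (a : ℍ) (ε : GnoSign L) (b : ℝ) : 0 ≤ hubActionIntegral a ε b := by
  unfold hubActionIntegral
  exact integral_nonneg fun η => actionIntegrand_nonneg b a ε η

/-- ★ `a ↦ hubActionIntegral a ε b` is strongly measurable in the hub. [folklore] -/
theorem stronglyMeasurable_hubActionIntegral (ε : GnoSign L) (b : ℝ) : StronglyMeasurable fun a : ℍ => hubActionIntegral a ε b := by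
  have hF : Measurable fun p : ℍ × GnoCoord L =>
      gnoDeficit z₀ (fun _ => 1) p.1 ε p.2 * Real.exp (-(b * gnoDeficit z₀ (fun _ => 1) p.1 ε p.2)) * gnoDensity p.2 :=
    ((measurable_gnoDeficit_uncurry z₀ (fun _ => 1) ε).mul
      (((measurable_gnoDeficit_uncurry z₀ (fun _ => 1) ε).const_mul b).neg.exp)).mul (measurable_gnoDensity.comp measurable_snd)
  have h := hF.stronglyMeasurable.integral_prod_right' (ν := (volume : Measure (GnoCoord L)))
  exact h

/-- `a ↦ hubActionIntegral a ε b` is integrable for the (probability) cone law (`b ≥ 0`). [folklore] -/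
theorem integrable_hubActionIntegral {b : ℝ} (hb : 0 ≤ b) (ε : GnoSign L) :
    Integrable (fun a : ℍ => hubActionIntegral a ε b) coneMeasure := by
  haveI := isProbabilityMeasure_coneMeasure
  obtain ⟨B, hB0, hB⟩ := exists_abs_gnoDeficit_le (L := L)
  refine (integrable_const (B * ∫ η : GnoCoord L, gnoDensity η)).mono' (stronglyMeasurable_hubActionIntegral ε b).aestronglyMeasurable
    (Filter.Eventually.of_forall fun a => ?_)
  rw [Real.norm_eq_abs, abs_of_nonneg (hubActionIntegral_nonneg a ε b)]
  unfold hubActionIntegral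
  rw [← integral_const_mul]
  refine integral_mono (integrable_actionIntegrand hb a ε) (integrable_gnoDensity.const_mul B) fun η => ?_
  have h1 : Real.exp (-(b * gnoDeficit z₀ (fun _ => 1) a ε η)) ≤ 1 :=
    Real.exp_le_one_iff.2 (by have := gnoDeficit_nonneg z₀ (fun _ => (1 : SU2)) a ε η; nlinarith)
  have h2 : gnoDeficit z₀ (fun _ => 1) a ε η ≤ B := (le_abs_self _).trans (hB a ε η)
  calc gnoDeficit z₀ (fun _ => 1) a ε η * Real.exp (-(b * gnoDeficit z₀ (fun _ => 1) a ε η)) * gnoDensity η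
      ≤ B * 1 * gnoDensity η := by
        refine mul_le_mul_of_nonneg_right ?_ (gnoDensity_pos η).le
        exact mul_le_mul h2 h1 (Real.exp_pos _).le hB0
    _ = B * gnoDensity η := by ring

/-- ★ A pointwise floor `κ ≤ b·F̂_{a,ε}` on the whole fibre gives `κ·I(a,ε;b) ≤ b·E(a,ε;b)` at the hub (`b ≥ 0`). [folklore] -/
theorem kappa_hubIntegral_le {κ b : ℝ} (hb : 0 ≤ b) {a : ℍ} {ε : GnoSign L} (hpt : ∀ η : GnoCoord L, κ ≤ b * gnoDeficit z₀ (fun _ => 1) a ε η) :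
    κ * hubIntegral a ε b ≤ b * hubActionIntegral a ε b := by
  unfold hubIntegral hubActionIntegral
  rw [← integral_const_mul, ← integral_const_mul]
  refine integral_mono ((integrable_fibreIntegrand hb a ε).const_mul κ) ((integrable_actionIntegrand hb a ε).const_mul b) fun η => ?_
  have h0 := fibreIntegrand_nonneg b a ε η
  calc κ * (Real.exp (-(b * gnoDeficit z₀ (fun _ => 1) a ε η)) * gnoDensity η)
      ≤ (b * gnoDeficit z₀ (fun _ => 1) a ε η) * (Real.exp (-(b * gnoDeficit z₀ (fun _ => 1) a ε η)) * gnoDensity η) :=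
        mul_le_mul_of_nonneg_right (hpt η) h0
    _ = b * (gnoDeficit z₀ (fun _ => 1) a ε η * Real.exp (-(b * gnoDeficit z₀ (fun _ => 1) a ε η)) * gnoDensity η) := by ring

/-! ## §2 The sector stiffness as a sum over regions -/

set_option maxHeartbeats 400000 in
/-- ★★ **`(TS)_000` AT FIXED `L`, `b`, FROM THE REGIONS**: cut `τ > 0`, any `κ`; if the bad sign patterns satisfy `κ ≤ b·F̂` pointwise at every hub `a ≠ 0`, and on
each of the three hub regions (tip, bulk, end) × the whole fibre the good-sign stiffness inequality `κ·Σ_{good}∫_R I ≤ b·Σ_{good}∫_R E` holds, then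
`κ·∫e^{−bF₀}dμ_L ≤ b·∫F₀e^{−bF₀}dμ_L` on the ring (chart identities, ✓`integral_eq_parts`, bad signs cone-a.e.). [cite: Luscher1983, §2] -/
theorem sectorStiffness_of_regions {κ τ b : ℝ} (hτ : 0 < τ) (hb : 0 < b)
    (hbad : ∀ a : ℍ, a ≠ 0 → ∀ ε : GnoSign L, ¬ GoodSign ε → ∀ η : GnoCoord L, κ ≤ b * gnoDeficit z₀ (fun _ => 1) a ε η)
    (htip : κ * ∑ ε ∈ (Finset.univ.filter fun ε : GnoSign L => GoodSign ε), ∫ a in TipHub τ, hubIntegral a ε b ∂coneMeasure ≤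
      b * ∑ ε ∈ (Finset.univ.filter fun ε : GnoSign L => GoodSign ε), ∫ a in TipHub τ, hubActionIntegral a ε b ∂coneMeasure)
    (hbulk : κ * ∑ ε ∈ (Finset.univ.filter fun ε : GnoSign L => GoodSign ε), ∫ a in HubBulk τ, hubIntegral a ε b ∂coneMeasure ≤
      b * ∑ ε ∈ (Finset.univ.filter fun ε : GnoSign L => GoodSign ε), ∫ a in HubBulk τ, hubActionIntegral a ε b ∂coneMeasure)
    (hend : κ * ∑ ε ∈ (Finset.univ.filter fun ε : GnoSign L => GoodSign ε), ∫ a in EndHub τ, hubIntegral a ε b ∂coneMeasure ≤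
      b * ∑ ε ∈ (Finset.univ.filter fun ε : GnoSign L => GoodSign ε), ∫ a in EndHub τ, hubActionIntegral a ε b ∂coneMeasure) :
    κ * ∫ P, Real.exp (-(b * swapRingDeficit L z₀ P)) ∂(ringMeasure L) ≤
      b * ∫ P, swapRingDeficit L z₀ P * Real.exp (-(b * swapRingDeficit L z₀ P)) ∂(ringMeasure L) := by
  haveI := isProbabilityMeasure_coneMeasure
  -- the chart identities
  have eZ : ∫ P, Real.exp (-(b * swapRingDeficit L z₀ P)) ∂(ringMeasure L) = KL L * ∫ a, (∑ ε : GnoSign L, hubIntegral a ε b) ∂coneMeasure := by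
    unfold KL hubIntegral
    exact integral_exp_swapDeficit_eq_gnomonic (L := L) z₀ hb.le
  have eE : ∫ P, swapRingDeficit L z₀ P * Real.exp (-(b * swapRingDeficit L z₀ P)) ∂(ringMeasure L) =
      KL L * ∫ a, (∑ ε : GnoSign L, hubActionIntegral a ε b) ∂coneMeasure := by
    unfold KL hubActionIntegral
    exact integral_swapDeficit_exp_eq_gnomonic (L := L) z₀ hb.le
  have hIi : ∀ ε : GnoSign L, Integrable (fun a : ℍ => hubIntegral a ε b) coneMeasure := fun ε => integrable_hubIntegral hb.le ε
  have hAi : ∀ ε : GnoSign L, Integrable (fun a : ℍ => hubActionIntegral a ε b) coneMeasure := fun ε => integrable_hubActionIntegral hb.le ε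
  rw [eZ, eE, integral_finsetSum _ fun ε _ => hIi ε, integral_finsetSum _ fun ε _ => hAi ε,
    ← Finset.sum_filter_add_sum_filter_not Finset.univ (fun ε : GnoSign L => GoodSign ε) (fun ε => ∫ a, hubIntegral a ε b ∂coneMeasure),
    ← Finset.sum_filter_add_sum_filter_not Finset.univ (fun ε : GnoSign L => GoodSign ε) (fun ε => ∫ a, hubActionIntegral a ε b ∂coneMeasure)]
  -- the good sign patterns: split every hub integral over the partition and add the three region inequalities
  have hgood : κ * ∑ ε ∈ (Finset.univ.filter fun ε : GnoSign L => GoodSign ε), ∫ a, hubIntegral a ε b ∂coneMeasure ≤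
      b * ∑ ε ∈ (Finset.univ.filter fun ε : GnoSign L => GoodSign ε), ∫ a, hubActionIntegral a ε b ∂coneMeasure := by
    have e1 : ∑ ε ∈ (Finset.univ.filter fun ε : GnoSign L => GoodSign ε), ∫ a, hubIntegral a ε b ∂coneMeasure =
        ∑ ε ∈ (Finset.univ.filter fun ε : GnoSign L => GoodSign ε), ∫ a in TipHub τ, hubIntegral a ε b ∂coneMeasure +
        ∑ ε ∈ (Finset.univ.filter fun ε : GnoSign L => GoodSign ε), ∫ a in EndHub τ, hubIntegral a ε b ∂coneMeasure +
        ∑ ε ∈ (Finset.univ.filter fun ε : GnoSign L => GoodSign ε), ∫ a in HubBulk τ, hubIntegral a ε b ∂coneMeasure := by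
      rw [← Finset.sum_add_distrib, ← Finset.sum_add_distrib]
      exact Finset.sum_congr rfl fun ε _ => integral_eq_parts (hIi ε) hτ
    have e2 : ∑ ε ∈ (Finset.univ.filter fun ε : GnoSign L => GoodSign ε), ∫ a, hubActionIntegral a ε b ∂coneMeasure =
        ∑ ε ∈ (Finset.univ.filter fun ε : GnoSign L => GoodSign ε), ∫ a in TipHub τ, hubActionIntegral a ε b ∂coneMeasure +
        ∑ ε ∈ (Finset.univ.filter fun ε : GnoSign L => GoodSign ε), ∫ a in EndHub τ, hubActionIntegral a ε b ∂coneMeasure +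
        ∑ ε ∈ (Finset.univ.filter fun ε : GnoSign L => GoodSign ε), ∫ a in HubBulk τ, hubActionIntegral a ε b ∂coneMeasure := by
      rw [← Finset.sum_add_distrib, ← Finset.sum_add_distrib]
      exact Finset.sum_congr rfl fun ε _ => integral_eq_parts (hAi ε) hτ
    rw [e1, e2, mul_add, mul_add, mul_add, mul_add]
    exact add_le_add (add_le_add htip hend) hbulk
  -- the bad sign patterns: pointwise at cone-a.e. hub
  have hbad' : κ * ∑ ε ∈ (Finset.univ.filter fun ε : GnoSign L => ¬ GoodSign ε), ∫ a, hubIntegral a ε b ∂coneMeasure ≤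
      b * ∑ ε ∈ (Finset.univ.filter fun ε : GnoSign L => ¬ GoodSign ε), ∫ a, hubActionIntegral a ε b ∂coneMeasure := by
    rw [Finset.mul_sum, Finset.mul_sum]
    refine Finset.sum_le_sum fun ε hε => ?_
    rw [Finset.mem_filter] at hε
    rw [← integral_const_mul, ← integral_const_mul]
    refine integral_mono_ae ((hIi ε).const_mul κ) ((hAi ε).const_mul b) ?_
    exact ae_re_ne_zero_im_ne_zero_coneMeasure.mono fun a ha =>
      kappa_hubIntegral_le hb.le (hbad a (fun h0 => ha.1 (by rw [h0]; rfl)) ε hε.2)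
  -- combine
  have hKL : 0 ≤ KL L := KL_nonneg
  have h := add_le_add hgood hbad'
  rw [← mul_add, ← mul_add] at h
  calc κ * (KL L * (∑ ε ∈ (Finset.univ.filter fun ε : GnoSign L => GoodSign ε), ∫ a, hubIntegral a ε b ∂coneMeasure +
        ∑ ε ∈ (Finset.univ.filter fun ε : GnoSign L => ¬ GoodSign ε), ∫ a, hubIntegral a ε b ∂coneMeasure))
      = KL L * (κ * (∑ ε ∈ (Finset.univ.filter fun ε : GnoSign L => GoodSign ε), ∫ a, hubIntegral a ε b ∂coneMeasure +
        ∑ ε ∈ (Finset.univ.filter fun ε : GnoSign L => ¬ GoodSign ε), ∫ a, hubIntegral a ε b ∂coneMeasure)) := by ring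
    _ ≤ KL L * (b * (∑ ε ∈ (Finset.univ.filter fun ε : GnoSign L => GoodSign ε), ∫ a, hubActionIntegral a ε b ∂coneMeasure +
        ∑ ε ∈ (Finset.univ.filter fun ε : GnoSign L => ¬ GoodSign ε), ∫ a, hubActionIntegral a ε b ∂coneMeasure)) :=
        mul_le_mul_of_nonneg_left h hKL
    _ = b * (KL L * (∑ ε ∈ (Finset.univ.filter fun ε : GnoSign L => GoodSign ε), ∫ a, hubActionIntegral a ε b ∂coneMeasure +
        ∑ ε ∈ (Finset.univ.filter fun ε : GnoSign L => ¬ GoodSign ε), ∫ a, hubActionIntegral a ε b ∂coneMeasure)) := by ring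

/-- The bad-sign remainder above the polynomial threshold: `b ≥ 8100·L¹⁰` and w3 g66's floor `F̂ ≥ 1∕(900L⁶)` give `stiffKappa L c ≤ b·F̂` (`c ≤ 3∕2`). [folklore] -/
theorem badSign_remainder {c b : ℝ} (hc : c ≤ 3 / 2) (hb : 8100 * (L : ℝ) ^ 10 ≤ b) :
    ∀ a : ℍ, a ≠ 0 → ∀ ε : GnoSign L, ¬ GoodSign ε → ∀ η : GnoCoord L, stiffKappa L c ≤ b * gnoDeficit z₀ (fun _ => 1) a ε η := by
  intro a ha ε hε η
  -- w3 g66's explicit floor `1/(900L⁶)` (the constant behind ✓`badSign_floor`)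
  have hL1 : (1 : ℝ) ≤ L := by exact_mod_cast NeZero.one_le
  have hL0 : (0 : ℝ) < L := by linarith
  have hF : 1 / (900 * (L : ℝ) ^ 6) ≤ gnoDeficit z₀ (fun _ => 1) a ε η := gnoDeficit_one_ge_of_not_flatPattern (L := L) ha ε hε η
  have hb0 : 0 ≤ b := le_trans (by positivity) hb
  have hκ : stiffKappa L c ≤ 9 * (L : ℝ) ^ 4 := by unfold stiffKappa; linarith
  have h9 : 9 * (L : ℝ) ^ 4 = 8100 * (L : ℝ) ^ 10 * (1 / (900 * (L : ℝ) ^ 6)) := by field_simp; ring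
  calc stiffKappa L c ≤ 9 * (L : ℝ) ^ 4 := hκ
    _ = 8100 * (L : ℝ) ^ 10 * (1 / (900 * (L : ℝ) ^ 6)) := h9
    _ ≤ b * gnoDeficit z₀ (fun _ => 1) a ε η := mul_le_mul hb hF (by positivity) hb0

/-! ## §3 From the region stubs of skeleton ➎ to the polynomial window of sector 000 -/

set_option maxHeartbeats 400000 in
/-- ★★ **`(TS)_000` ON A POLYNOMIAL WINDOW FROM THE THREE REGION STUBS.**  Each region stub says: `∃ K > 0, k, τ₀ ∈ (0, 1∕2]` such that for every `L`, every cut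
`0 < τ ≤ τ₀∕L^k` and every `b ≥ K·L^k·τ^{−k}`, the good-sign stiffness inequality with `κ = stiffKappa L (1∕8)` holds on (tip ∕ bulk ∕ end hubs at cut `τ`) × fibre.
Then, with ONE common cut `τ(L) = τ₀∕L^k` (`τ₀ = min`, `k = max`) and the bad signs above `8100L¹⁰`: `∃ K q, ∀ L b, K·L^q ≤ b → stiffKappa L (1∕8)·∫e^{−bF₀} ≤ b·∫F₀e^{−bF₀}`.
[cite: Luscher1983, §2] -/
theorem h000_of_region_stubs
    (htip : ∃ K : ℝ, 0 < K ∧ ∃ k : ℕ, ∃ τ₀ : ℝ, 0 < τ₀ ∧ τ₀ ≤ 1 / 2 ∧ ∀ (L : ℕ) [NeZero L] (τ : ℝ), 0 < τ → τ ≤ τ₀ / (L : ℝ) ^ k →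
      ∀ b : ℝ, K * (L : ℝ) ^ k * τ⁻¹ ^ k ≤ b →
        stiffKappa L (1 / 8) * ∑ ε ∈ (Finset.univ.filter fun ε : GnoSign L => GoodSign ε), ∫ a in TipHub τ, hubIntegral a ε b ∂coneMeasure ≤
          b * ∑ ε ∈ (Finset.univ.filter fun ε : GnoSign L => GoodSign ε), ∫ a in TipHub τ, hubActionIntegral a ε b ∂coneMeasure)
    (hbulk : ∃ K : ℝ, 0 < K ∧ ∃ k : ℕ, ∃ τ₀ : ℝ, 0 < τ₀ ∧ τ₀ ≤ 1 / 2 ∧ ∀ (L : ℕ) [NeZero L] (τ : ℝ), 0 < τ → τ ≤ τ₀ / (L : ℝ) ^ k →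
      ∀ b : ℝ, K * (L : ℝ) ^ k * τ⁻¹ ^ k ≤ b →
        stiffKappa L (1 / 8) * ∑ ε ∈ (Finset.univ.filter fun ε : GnoSign L => GoodSign ε), ∫ a in HubBulk τ, hubIntegral a ε b ∂coneMeasure ≤
          b * ∑ ε ∈ (Finset.univ.filter fun ε : GnoSign L => GoodSign ε), ∫ a in HubBulk τ, hubActionIntegral a ε b ∂coneMeasure)
    (hend : ∃ K : ℝ, 0 < K ∧ ∃ k : ℕ, ∃ τ₀ : ℝ, 0 < τ₀ ∧ τ₀ ≤ 1 / 2 ∧ ∀ (L : ℕ) [NeZero L] (τ : ℝ), 0 < τ → τ ≤ τ₀ / (L : ℝ) ^ k →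
      ∀ b : ℝ, K * (L : ℝ) ^ k * τ⁻¹ ^ k ≤ b →
        stiffKappa L (1 / 8) * ∑ ε ∈ (Finset.univ.filter fun ε : GnoSign L => GoodSign ε), ∫ a in EndHub τ, hubIntegral a ε b ∂coneMeasure ≤
          b * ∑ ε ∈ (Finset.univ.filter fun ε : GnoSign L => GoodSign ε), ∫ a in EndHub τ, hubActionIntegral a ε b ∂coneMeasure) :
    ∃ K : ℝ, 0 < K ∧ ∃ q : ℕ, ∀ (L : ℕ) [NeZero L] (b : ℝ), K * (L : ℝ) ^ q ≤ b →
      stiffKappa L (1 / 8) * ∫ P, Real.exp (-(b * swapRingDeficit L z₀ P)) ∂(ringMeasure L) ≤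
        b * ∫ P, swapRingDeficit L z₀ P * Real.exp (-(b * swapRingDeficit L z₀ P)) ∂(ringMeasure L) := by
  obtain ⟨Kt, hKt, kt, τt, hτt, hτt1, ht⟩ := htip
  obtain ⟨Kb, hKb, kb, τb, hτb, hτb1, hbk⟩ := hbulk
  obtain ⟨Ke, hKe, ke, τe, hτe, hτe1, he⟩ := hend
  -- common cut exponent and cut size
  set k : ℕ := max kt (max kb ke) with hk
  set τ₀ : ℝ := min τt (min τb τe) with hτ₀
  have hτ₀0 : 0 < τ₀ := lt_min hτt (lt_min hτb hτe)
  have hτ₀1 : τ₀ ≤ 1 / 2 := (min_le_left _ _).trans hτt1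
  have hτ₀t : τ₀ ≤ τt := min_le_left _ _
  have hτ₀b : τ₀ ≤ τb := (min_le_right _ _).trans (min_le_left _ _)
  have hτ₀e : τ₀ ≤ τe := (min_le_right _ _).trans (min_le_right _ _)
  have hkt : kt ≤ k := le_max_left _ _
  have hkb : kb ≤ k := (le_max_left _ _).trans (le_max_right _ _)
  have hke : ke ≤ k := (le_max_right _ _).trans (le_max_right _ _)
  -- the window constant
  refine ⟨(Kt + Kb + Ke) / τ₀ ^ k + 8100, by positivity, k + k * k + 10, fun L _ b hb => ?_⟩
  have hL1 : (1 : ℝ) ≤ L := by exact_mod_cast NeZero.one_le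
  have hL0 : (0 : ℝ) < L := by linarith
  -- the cut at this `L`
  set τ : ℝ := τ₀ / (L : ℝ) ^ k with hτdef
  have hLk : (1 : ℝ) ≤ (L : ℝ) ^ k := one_le_pow₀ hL1
  have hLk0 : (0 : ℝ) < (L : ℝ) ^ k := by positivity
  have hτ0 : 0 < τ := div_pos hτ₀0 hLk0
  have hτle : ∀ {τ' : ℝ} {k' : ℕ}, τ₀ ≤ τ' → k' ≤ k → τ ≤ τ' / (L : ℝ) ^ k' := fun hτ' hk' =>
    div_le_div₀ (le_trans hτ₀0.le hτ') hτ' (by positivity) (pow_le_pow_right₀ hL1 hk')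
  -- the inverse cut: `τ⁻¹ = L^k/τ₀ ≥ 1`
  have eτi : τ⁻¹ = (L : ℝ) ^ k / τ₀ := by rw [hτdef, inv_div]
  have hτi1 : 1 ≤ τ⁻¹ := by
    rw [eτi, le_div_iff₀ hτ₀0]; linarith
  -- the threshold of each region: `K_i L^{k_i} τ^{−k_i} ≤ ((Kt+Kb+Ke)/τ₀^k)·L^{k + k²} ≤ b`
  have hbig : (Kt + Kb + Ke) / τ₀ ^ k * (L : ℝ) ^ (k + k * k) ≤ b := by
    have h1 : (Kt + Kb + Ke) / τ₀ ^ k * (L : ℝ) ^ (k + k * k) ≤ ((Kt + Kb + Ke) / τ₀ ^ k + 8100) * (L : ℝ) ^ (k + k * k + 10) := by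
      have hLm : (L : ℝ) ^ (k + k * k) ≤ (L : ℝ) ^ (k + k * k + 10) := pow_le_pow_right₀ hL1 (by omega)
      have h0 : 0 ≤ (Kt + Kb + Ke) / τ₀ ^ k := by positivity
      nlinarith [hLm, h0, one_le_pow₀ (n := k + k * k + 10) hL1]
    exact h1.trans hb
  have hthr : ∀ {K' : ℝ} {k' : ℕ}, 0 < K' → K' ≤ Kt + Kb + Ke → k' ≤ k → K' * (L : ℝ) ^ k' * τ⁻¹ ^ k' ≤ b := by
    intro K' k' hK' hK'le hk'
    have h1 : τ⁻¹ ^ k' ≤ τ⁻¹ ^ k := pow_le_pow_right₀ hτi1 hk'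
    have h2 : τ⁻¹ ^ k = (L : ℝ) ^ (k * k) / τ₀ ^ k := by rw [eτi, div_pow, ← pow_mul]
    have h3 : (L : ℝ) ^ k' ≤ (L : ℝ) ^ k := pow_le_pow_right₀ hL1 hk'
    calc K' * (L : ℝ) ^ k' * τ⁻¹ ^ k' ≤ (Kt + Kb + Ke) * (L : ℝ) ^ k * τ⁻¹ ^ k :=
          mul_le_mul (mul_le_mul hK'le h3 (by positivity) (by linarith)) h1 (by positivity) (by positivity)
      _ = (Kt + Kb + Ke) / τ₀ ^ k * (L : ℝ) ^ (k + k * k) := by rw [h2, pow_add]; field_simp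
      _ ≤ b := hbig
  -- the bad-sign threshold
  have hbad_thr : 8100 * (L : ℝ) ^ 10 ≤ b := by
    have h1 : 8100 * (L : ℝ) ^ 10 ≤ ((Kt + Kb + Ke) / τ₀ ^ k + 8100) * (L : ℝ) ^ (k + k * k + 10) := by
      have hLm : (L : ℝ) ^ 10 ≤ (L : ℝ) ^ (k + k * k + 10) := pow_le_pow_right₀ hL1 (by omega)
      have h0 : 0 ≤ (Kt + Kb + Ke) / τ₀ ^ k := by positivity
      nlinarith [hLm, h0, one_le_pow₀ (n := k + k * k + 10) hL1, pow_nonneg hL0.le 10]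
    exact h1.trans hb
  have hb0 : 0 < b := lt_of_lt_of_le (by positivity) hbad_thr
  exact sectorStiffness_of_regions hτ0 hb0 (badSign_remainder (by norm_num) hbad_thr)
    (ht L τ hτ0 (hτle hτ₀t hkt) b (hthr hKt (by linarith) hkt))
    (hbk L τ hτ0 (hτle hτ₀b hkb) b (hthr hKb (by linarith) hkb))
    (he L τ hτ0 (hτle hτ₀e hke) b (hthr hKe (by linarith) hke))

end Summit.QuantumFields.YangMills.Theorems.SwapVirialDeficit.SectorLaplace

end
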